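import Literature.Geometry.Lorentzian.SpacetimeChartDeviationTransfer
import Literature.Geometry.Lorentzian.MultiCentreKerrSchild
import Literature.Geometry.Lorentzian.SpacetimeLocalConvergenceChartOrientation
import Literature.Geometry.Manifold.InverseFunctionTheoremVectorSpace
import HarnessLib

/-!
# Charts on the domain of a model background: components, deviation, immersion, orientation

Calculus of chart maps `Ψ : B.domain → 𝓢` from the (open) domain of a `ModelBackground` into a
spacetime, relating the two vocabularies of the tree: the METRIC COMPONENTS
`Spacetime.metricInCoords (Ψ ∘ (chartAt E4 x).symm)` of the associated parametrisation (the
language of pointed `Cᵏ_loc` convergence, `SpacetimeLocalConvergence.lean`) and the DEVIATION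
`Spacetime.deviation B Ψ = Ψ^* g − g₀` (the language of late-time charts and of the tameness
hypotheses of the Final State Conjecture routes, `KerrConvergence.lean`):

* `metricInCoords (Ψ ∘ (chartAt E4 x).symm) y = (Ψ^* g − g₀)(y) + g₀(y)` on the domain, the same
  germs / `Cᵏ` sup norms for `metricInCoords − g₀` and `deviationExtend B Ψ`
  (`supCkENorm_metricInCoords_comp_chartAt_symm_sub`);
* a smooth chart whose components are nondegenerate — e.g. `C⁰`-PINCHED, `‖Ψ^* g − η‖ < 1` — is an
  immersion between equidimensional manifolds, hence a LOCAL DIFFEOMORPHISM (inverse function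
  theorem; O'Neill 1983, Ch. 3, p. 90 and Ch. 5, Lemma 5.26): `isLocalDiffeomorph_of_norm_deviationExtend_lt_one`;
* a pinched chart pushes `∂₀` to a timelike vector, so on a connected domain its time-orientation
  is decided at one point (`isFutureDirected_mfderiv_basisVector_zero_of_norm_deviationExtend_lt_one`);
* the inclusion of an open submanifold is a local diffeomorphism (`isLocalDiffeomorph_subtypeVal`).

These are the chart-side inputs of the local Cheeger–Gromov compactness theorem for uniformly tame
pointed spacetimes (`TameChartCompactness.lean`).

## References
* B. O'Neill, *Semi-Riemannian geometry*, Academic Press 1983, Ch. 3, p. 90; Ch. 5, Lemma 5.26. [ONeill1983]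
* M. Dafermos, G. Holzegel, I. Rodnianski, M. Taylor, arXiv:2104.08222, §1 (deviation from a background). [arXiv210408222]
-/

noncomputable section

open Set Filter TopologicalSpace Bundle Function
open scoped Manifold ContDiff Topology

universe u

namespace Literature.Geometry.Lorentzian

/-! ### Inclusions of open submanifolds -/

section SubtypeVal

variable {E : Type*} [NormedAddCommGroup E] [NormedSpace ℝ E] {H : Type*} [TopologicalSpace H]
  {I : ModelWithCorners ℝ E H} {M : Type*} [TopologicalSpace M] [ChartedSpace H M]

/-- **The inclusion of an open submanifold is a smooth local diffeomorphism** (for the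
open-submanifold charted structure `Opens.instChartedSpace`): the partial homeomorphism `↥W ≃ W` is
smooth in both directions. O'Neill 1983, Ch. 1, p. 4 (open submanifolds). [cite: ONeill1983, Ch. 1, p. 4] -/
theorem isLocalDiffeomorph_subtypeVal [IsManifold I ∞ M] (W : Opens M) :
    IsLocalDiffeomorph I I ∞ (Subtype.val : W → M) := by
  intro x
  have hne : Nonempty W := ⟨x⟩
  set c := W.openPartialHomeomorphSubtypeCoe hne with hc
  have h1 : ContMDiffOn I I ∞ c c.source := by
    rw [hc, TopologicalSpace.Opens.openPartialHomeomorphSubtypeCoe_source]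
    exact (contMDiff_subtype_val.contMDiffOn (s := univ)).congr fun z _ ↦ by simp
  have h2 : ContMDiffOn I I ∞ c.symm c.target := by
    have key : EqOn (Subtype.val ∘ c.symm) id c.target := fun w hw ↦ c.right_inv hw
    intro z hz
    have h3 : ContMDiffWithinAt I I ∞ (Subtype.val ∘ c.symm) c.target z :=
      contMDiffWithinAt_id.congr key (key hz)
    exact (ContMDiffWithinAt.subtypeVal_comp_iff W _ _ _).1 h3
  let Φ : PartialDiffeomorph I I W M ∞ :=
    { toPartialEquiv := c.toPartialEquiv
      open_source := c.open_source
      open_target := c.open_target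
      contMDiffOn_toFun := h1
      contMDiffOn_invFun := h2 }
  refine ⟨Φ, ?_, fun q _ ↦ ?_⟩
  · show x ∈ c.source
    rw [hc, TopologicalSpace.Opens.openPartialHomeomorphSubtypeCoe_source]
    exact mem_univ _
  · show Subtype.val q = c q
    rw [hc, TopologicalSpace.Opens.openPartialHomeomorphSubtypeCoe_coe]

end SubtypeVal

/-! ### Charts on the domain of a model background: metric components versus `deviation` -/

namespace Spacetime

variable (𝓢 : Spacetime.{u} 4) (B : ModelBackground)

/-- All preferred charts of an open submanifold `↥O ⊆ E4` are the same inclusion. [folklore] -/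
theorem _root_.Literature.Geometry.Lorentzian.OpensChart.chartAt_eq_chartAt {O : Opens E4}
    (x x' : O) : chartAt E4 x = chartAt E4 x' := rfl

/-- The inverse chart followed by the inclusion is the identity of `↥O`:
`(Ψ ∘ (chartAt E4 x).symm) ∘ Subtype.val = Ψ`. [folklore] -/
theorem comp_chartAt_symm_comp_subtypeVal {O : Opens E4} {X : Type*} (Ψ : O → X) (x : O) :
    (Ψ ∘ (chartAt E4 x).symm) ∘ (Subtype.val : O → E4) = Ψ := by
  funext z
  simp only [comp_apply]
  congr 1
  have hz : z ∈ (chartAt E4 x).source := by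
    rw [OpensChart.chartAt_source]; exact mem_univ _
  have h := (chartAt E4 x).left_inv hz
  rwa [OpensChart.chartAt_apply] at h

/-- A chart map `Ψ : B.domain → 𝓢` differentiable at `⟨y, hy⟩` gives a parametrisation
`Ψ ∘ (chartAt E4 x).symm : E4 → 𝓢` differentiable at `y`. [folklore] -/
theorem mdifferentiableAt_comp_chartAt_symm (Ψ : B.domain → 𝓢.carrier) (x : B.domain) {y : E4}
    (hy : y ∈ (B.domain : Set E4)) (hΨ : MDifferentiableAt 𝓘(ℝ, E4) (𝓡 4) Ψ ⟨y, hy⟩) :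
    MDifferentiableAt 𝓘(ℝ, E4) (𝓡 4) (Ψ ∘ (chartAt E4 x).symm) y := by
  have hc : MDifferentiableAt 𝓘(ℝ, E4) 𝓘(ℝ, E4) (chartAt E4 x).symm y := by
    have h := mdifferentiableWithinAt_extChartAt_symm (I := 𝓘(ℝ, E4)) (x := x)
      (show y ∈ (extChartAt 𝓘(ℝ, E4) x).target by rwa [OpensChart.extChartAt_target])
    rw [ModelWithCorners.range_eq_univ, mdifferentiableWithinAt_univ, OpensChart.extChartAt_eq] at h
    exact h
  have hp : (chartAt E4 x).symm y = ⟨y, hy⟩ := Subtype.ext (OpensChart.chartAt_symm_val x hy)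
  rw [← hp] at hΨ
  exact hΨ.comp y hc

/-- A smooth chart map `Ψ : B.domain → 𝓢` gives a parametrisation `Ψ ∘ (chartAt E4 x).symm`
smooth on `B.domain`. [folklore] -/
theorem contMDiffOn_comp_chartAt_symm (Ψ : B.domain → 𝓢.carrier) (x : B.domain)
    (hΨ : ContMDiff 𝓘(ℝ, E4) (𝓡 4) ∞ Ψ) :
    ContMDiffOn 𝓘(ℝ, E4) (𝓡 4) ∞ (Ψ ∘ (chartAt E4 x).symm) B.domain := by
  have h := hΨ.comp_contMDiffOn (contMDiffOn_chart_symm (H := E4) (I := 𝓘(ℝ, E4)) (x := x))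
  rwa [OpensChart.chartAt_target] at h

/-- **Metric components of a chart on the background domain = pulled-back metric**: for
`Ψ : B.domain → 𝓢` differentiable at `⟨y, hy⟩`, the components
`metricInCoords (Ψ ∘ (chartAt E4 x).symm) y` of the parametrisation are the pullback
`(Ψ^* g)_{⟨y,hy⟩}` over the open submanifold `B.domain`. [cite: ONeill1983, Ch. 3, Def. 3.9] -/
theorem metricInCoords_comp_chartAt_symm_apply (Ψ : B.domain → 𝓢.carrier) (x : B.domain)
    {y : E4} (hy : y ∈ (B.domain : Set E4)) (hΨ : MDifferentiableAt 𝓘(ℝ, E4) (𝓡 4) Ψ ⟨y, hy⟩)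
    (v w : E4) :
    𝓢.metricInCoords (Ψ ∘ (chartAt E4 x).symm) y v w =
      𝓢.metric.val (Ψ ⟨y, hy⟩) (mfderiv 𝓘(ℝ, E4) (𝓡 4) Ψ ⟨y, hy⟩ v)
        (mfderiv 𝓘(ℝ, E4) (𝓡 4) Ψ ⟨y, hy⟩ w) := by
  have h := 𝓢.pullbackBilin_comp_subtypeVal_eq_metricInCoords (U := B.domain)
    (ψ := Ψ ∘ (chartAt E4 x).symm) ⟨y, hy⟩ (𝓢.mdifferentiableAt_comp_chartAt_symm B Ψ x hy hΨ)
  rw [comp_chartAt_symm_comp_subtypeVal] at h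
  rw [← h]
  rfl

/-- **Metric components of a chart on the background domain = background + deviation**:
`metricInCoords (Ψ ∘ (chartAt E4 x).symm) y = (Ψ^* g − g₀)_{⟨y,hy⟩} + g₀(y)`
(`Spacetime.deviation`). [cite: arXiv210408222, §1] -/
theorem metricInCoords_comp_chartAt_symm_eq_deviation_add (Ψ : B.domain → 𝓢.carrier)
    (x : B.domain) {y : E4} (hy : y ∈ (B.domain : Set E4))
    (hΨ : MDifferentiableAt 𝓘(ℝ, E4) (𝓡 4) Ψ ⟨y, hy⟩) :
    𝓢.metricInCoords (Ψ ∘ (chartAt E4 x).symm) y = 𝓢.deviation B Ψ ⟨y, hy⟩ + B.bilin y := by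
  ext v w
  rw [𝓢.metricInCoords_comp_chartAt_symm_apply B Ψ x hy hΨ, add_apply, add_apply,
    Spacetime.deviation_apply]
  ring

/-- Equivalently: components minus background = deviation. [cite: arXiv210408222, §1] -/
theorem metricInCoords_comp_chartAt_symm_sub_eq_deviation (Ψ : B.domain → 𝓢.carrier)
    (x : B.domain) {y : E4} (hy : y ∈ (B.domain : Set E4))
    (hΨ : MDifferentiableAt 𝓘(ℝ, E4) (𝓡 4) Ψ ⟨y, hy⟩) :
    𝓢.metricInCoords (Ψ ∘ (chartAt E4 x).symm) y - B.bilin y = 𝓢.deviation B Ψ ⟨y, hy⟩ := by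
  ext v w
  rw [sub_apply, sub_apply, 𝓢.metricInCoords_comp_chartAt_symm_apply B Ψ x hy hΨ,
    Spacetime.deviation_apply]

/-- The same with the zero-extended deviation `deviationExtend`. [cite: arXiv210408222, §1] -/
theorem metricInCoords_comp_chartAt_symm_eq_deviationExtend_add (Ψ : B.domain → 𝓢.carrier)
    (x : B.domain) {y : E4} (hy : y ∈ (B.domain : Set E4))
    (hΨ : MDifferentiableAt 𝓘(ℝ, E4) (𝓡 4) Ψ ⟨y, hy⟩) :
    𝓢.metricInCoords (Ψ ∘ (chartAt E4 x).symm) y = 𝓢.deviationExtend B Ψ y + B.bilin y := by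
  rw [𝓢.metricInCoords_comp_chartAt_symm_eq_deviation_add B Ψ x hy hΨ,
    𝓢.deviationExtend_coe B Ψ ⟨y, hy⟩]

/-- **The components minus the background and the extended deviation have the same germ at points
of the domain** (for a smooth chart map). [folklore] -/
theorem metricInCoords_comp_chartAt_symm_sub_eventuallyEq (Ψ : B.domain → 𝓢.carrier)
    (x : B.domain) (hΨ : ContMDiff 𝓘(ℝ, E4) (𝓡 4) ∞ Ψ) {y : E4} (hy : y ∈ (B.domain : Set E4)) :
    (𝓢.metricInCoords (Ψ ∘ (chartAt E4 x).symm) - B.bilin) =ᶠ[𝓝 y] 𝓢.deviationExtend B Ψ := by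
  filter_upwards [B.domain.2.mem_nhds hy] with z hz
  rw [Pi.sub_apply, 𝓢.metricInCoords_comp_chartAt_symm_sub_eq_deviation B Ψ x hz
    ((hΨ ⟨z, hz⟩).mdifferentiableAt (by simp)), 𝓢.deviationExtend_coe B Ψ ⟨z, hz⟩]

/-- **`Cᵏ` sup norms of the components minus the background over subsets of the domain are those
of the deviation** (the tameness hypotheses of the Final State Conjecture routes are stated through
`supCkENorm _ k (deviationExtend B Ψ)`). [folklore] -/
theorem supCkENorm_metricInCoords_comp_chartAt_symm_sub (Ψ : B.domain → 𝓢.carrier) (x : B.domain)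
    (hΨ : ContMDiff 𝓘(ℝ, E4) (𝓡 4) ∞ Ψ) {K : Set E4} (hK : K ⊆ (B.domain : Set E4)) (k : ℕ) :
    supCkENorm K k (𝓢.metricInCoords (Ψ ∘ (chartAt E4 x).symm) - B.bilin) =
      supCkENorm K k (𝓢.deviationExtend B Ψ) :=
  supCkENorm_congr fun _ hy ↦ 𝓢.metricInCoords_comp_chartAt_symm_sub_eventuallyEq B Ψ x hΨ (hK hy)

/-- Pointwise form: `‖metricInCoords (Ψ ∘ (chartAt E4 x).symm) y − g₀(y)‖ = ‖deviationExtend B Ψ y‖`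
on the domain. [folklore] -/
theorem norm_metricInCoords_comp_chartAt_symm_sub (Ψ : B.domain → 𝓢.carrier) (x : B.domain)
    (hΨ : ContMDiff 𝓘(ℝ, E4) (𝓡 4) ∞ Ψ) {y : E4} (hy : y ∈ (B.domain : Set E4)) :
    ‖𝓢.metricInCoords (Ψ ∘ (chartAt E4 x).symm) y - B.bilin y‖ = ‖𝓢.deviationExtend B Ψ y‖ := by
  rw [𝓢.metricInCoords_comp_chartAt_symm_sub_eq_deviation B Ψ x hy
    ((hΨ ⟨y, hy⟩).mdifferentiableAt (by simp)), 𝓢.deviationExtend_coe B Ψ ⟨y, hy⟩]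

/-- **Differential of the parametrisation through the inclusion chart**: for `y` in the domain,
`d(Ψ ∘ (chartAt E4 x).symm)_y = dΨ_{⟨y,hy⟩}` (the inverse chart has identity differential).
[folklore] -/
theorem mfderiv_comp_chartAt_symm_apply (Ψ : B.domain → 𝓢.carrier) (x : B.domain) {y : E4}
    (hy : y ∈ (B.domain : Set E4)) (hΨ : MDifferentiableAt 𝓘(ℝ, E4) (𝓡 4) Ψ ⟨y, hy⟩) (v : E4) :
    mfderiv 𝓘(ℝ, E4) (𝓡 4) (Ψ ∘ (chartAt E4 x).symm) y v =
      mfderiv 𝓘(ℝ, E4) (𝓡 4) Ψ ⟨y, hy⟩ v := by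
  have h := 𝓢.mfderiv_comp_subtypeVal_opens (U := B.domain) (ψ := Ψ ∘ (chartAt E4 x).symm) ⟨y, hy⟩
    (𝓢.mdifferentiableAt_comp_chartAt_symm B Ψ x hy hΨ)
  rw [comp_chartAt_symm_comp_subtypeVal] at h
  exact (DFunLike.congr_fun h v).symm

/-! ### Charts with nondegenerate (e.g. pinched) components are local diffeomorphisms -/

/-- **Nondegenerate components force an injective differential**: if the bilinear form
`metricInCoords ψ y = g_{ψ y}(dψ_y ·, dψ_y ·)` is nondegenerate then `dψ_y` is injective (a vector
in its kernel pairs to zero with everything). [cite: ONeill1983, Ch. 3, p. 90] -/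
theorem injective_mfderiv_of_metricInCoords_nondegenerate {ψ : E4 → 𝓢.carrier} {y : E4}
    (hnd : ∀ v : E4, (∀ w : E4, 𝓢.metricInCoords ψ y v w = 0) → v = 0) :
    Injective (mfderiv 𝓘(ℝ, E4) (𝓡 4) ψ y) := by
  refine (injective_iff_map_eq_zero (mfderiv 𝓘(ℝ, E4) (𝓡 4) ψ y)).2 fun v hv ↦ hnd v fun w ↦ ?_
  rw [metricInCoords_apply, hv, map_zero, zero_apply]

/-- **A smooth parametrisation with nondegenerate components is a local diffeomorphism**
(equidimensional: an injective differential `E4 → T𝓢` is invertible; inverse function theorem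
`isLocalDiffeomorphAt_of_mfderiv_of_normedSpace`). [cite: ONeill1983, Ch. 3, p. 90] -/
theorem isLocalDiffeomorphAt_of_metricInCoords_nondegenerate {ψ : E4 → 𝓢.carrier} {O : Set E4}
    (hO : IsOpen O) (hψ : ContMDiffOn 𝓘(ℝ, E4) (𝓡 4) ∞ ψ O) {y : E4} (hy : y ∈ O)
    (hnd : ∀ v : E4, (∀ w : E4, 𝓢.metricInCoords ψ y v w = 0) → v = 0) :
    IsLocalDiffeomorphAt 𝓘(ℝ, E4) (𝓡 4) ∞ ψ y := by
  set A : E4 →L[ℝ] E4 := mfderiv 𝓘(ℝ, E4) (𝓡 4) ψ y with hA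
  have hinj : Injective A := 𝓢.injective_mfderiv_of_metricInCoords_nondegenerate hnd
  have hsurj : Surjective A := by
    have h := (LinearMap.injective_iff_surjective (f := (A : E4 →ₗ[ℝ] E4))).1 hinj
    exact h
  let e : E4 ≃L[ℝ] E4 := (LinearEquiv.ofBijective (A : E4 →ₗ[ℝ] E4) ⟨hinj, hsurj⟩).toContinuousLinearEquiv
  have he : mfderiv 𝓘(ℝ, E4) (𝓡 4) ψ y = (e : E4 →L[ℝ] E4) := by
    ext v
    rfl
  exact Literature.Geometry.Manifold.isLocalDiffeomorphAt_of_mfderiv_of_normedSpace (n := ∞)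
    (by simp) hO hy hψ e he

/-- The components `metricInCoords ψ y` are nondegenerate as soon as they are `C⁰`-close to the
Minkowski form: `‖metricInCoords ψ y − η‖ < 1`. [cite: ONeill1983, Ch. 5, Lemma 5.26] -/
theorem metricInCoords_nondegenerate_of_norm_sub_lt_one {ψ : E4 → 𝓢.carrier} {y : E4}
    (h : ‖𝓢.metricInCoords ψ y - Minkowski.bilin‖ < 1) :
    ∀ v : E4, (∀ w : E4, 𝓢.metricInCoords ψ y v w = 0) → v = 0 :=
  fun v hv ↦ Minkowski.nondegenerate_of_spatial_pos (fun v w ↦ 𝓢.metricInCoords_symm ψ y v w)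
    (fun _ hu0 hu ↦ Minkowski.apply_self_pos_of_norm_sub_bilin_lt_one h hu0 hu)
    (Minkowski.apply_basisVector_zero_neg_of_norm_sub_bilin_lt_one h) v hv

/-- **A `C⁰`-pinched smooth parametrisation is a local diffeomorphism**: `‖ψ^* g(y) − η‖ < 1` at a
point `y` of an open set on which `ψ` is smooth forces `dψ_y` to be invertible.
[cite: ONeill1983, Ch. 5, Lemma 5.26] -/
theorem isLocalDiffeomorphAt_of_norm_metricInCoords_sub_lt_one {ψ : E4 → 𝓢.carrier} {O : Set E4}
    (hO : IsOpen O) (hψ : ContMDiffOn 𝓘(ℝ, E4) (𝓡 4) ∞ ψ O) {y : E4} (hy : y ∈ O)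
    (h : ‖𝓢.metricInCoords ψ y - Minkowski.bilin‖ < 1) :
    IsLocalDiffeomorphAt 𝓘(ℝ, E4) (𝓡 4) ∞ ψ y :=
  𝓢.isLocalDiffeomorphAt_of_metricInCoords_nondegenerate hO hψ hy
    (𝓢.metricInCoords_nondegenerate_of_norm_sub_lt_one h)

/-- **`∂₀` is pushed to a timelike vector by a `C⁰`-pinched parametrisation**:
`g(dψ ∂₀, dψ ∂₀) = (ψ^* g)(∂₀, ∂₀) ≤ −1 + ‖ψ^* g − η‖ < 0`. [cite: ONeill1983, Ch. 5, Lemma 5.26] -/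
theorem isTimelike_mfderiv_basisVector_zero_of_norm_metricInCoords_sub_lt_one
    {ψ : E4 → 𝓢.carrier} {y : E4} (h : ‖𝓢.metricInCoords ψ y - Minkowski.bilin‖ < 1) :
    𝓢.metric.IsTimelike (mfderiv 𝓘(ℝ, E4) (𝓡 4) ψ y (E4.basisVector 0)) := by
  have h1 := Minkowski.apply_basisVector_zero_neg_of_norm_sub_bilin_lt_one h
  rwa [metricInCoords_apply] at h1

/-- **Subtype-chart form of the local diffeomorphism property.** A smooth chart map
`Ψ : ↥O → 𝓢` whose deviation from the Minkowski background on `O` is `C⁰`-pinched,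
`‖(Ψ^* g − η)(y)‖ < 1` on `O`, is a local diffeomorphism of the open submanifold `↥O` into `𝓢`
(composition of the pinched parametrisation `Ψ ∘ (chartAt E4 x).symm` with the inclusion).
[cite: ONeill1983, Ch. 5, Lemma 5.26] -/
theorem isLocalDiffeomorph_of_norm_deviationExtend_lt_one {O : Opens E4} (Ψ : O → 𝓢.carrier)
    (hΨ : ContMDiff 𝓘(ℝ, E4) (𝓡 4) ∞ Ψ)
    (h : ∀ y ∈ (O : Set E4), ‖𝓢.deviationExtend (Minkowski.backgroundOn O) Ψ y‖ < 1) :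
    IsLocalDiffeomorph 𝓘(ℝ, E4) (𝓡 4) ∞ Ψ := by
  intro z
  have hz : (z : E4) ∈ (O : Set E4) := z.2
  have hψ : ContMDiffOn 𝓘(ℝ, E4) (𝓡 4) ∞ (Ψ ∘ (chartAt E4 z).symm) O :=
    𝓢.contMDiffOn_comp_chartAt_symm (Minkowski.backgroundOn O) Ψ z hΨ
  have hn : ‖𝓢.metricInCoords (Ψ ∘ (chartAt E4 z).symm) z - Minkowski.bilin‖ < 1 :=
    (𝓢.norm_metricInCoords_comp_chartAt_symm_sub (Minkowski.backgroundOn O) Ψ z hΨ hz).trans_lt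
      (h z hz)
  have h1 : IsLocalDiffeomorphAt 𝓘(ℝ, E4) (𝓡 4) ∞ (Ψ ∘ (chartAt E4 z).symm) (z : E4) :=
    𝓢.isLocalDiffeomorphAt_of_norm_metricInCoords_sub_lt_one O.2 hψ hz hn
  have h2 : IsLocalDiffeomorphAt 𝓘(ℝ, E4) (𝓡 4) ∞ ((Ψ ∘ (chartAt E4 z).symm) ∘ (Subtype.val : O → E4)) z :=
    IsLocalDiffeomorphAt.comp (hf := isLocalDiffeomorph_subtypeVal (I := 𝓘(ℝ, E4)) O z) (hg := h1)
  rwa [comp_chartAt_symm_comp_subtypeVal] at h2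

/-- **Orientation of a pinched chart from its orientation at one point.** For a smooth chart map
`Ψ : ↥O → 𝓢` on a connected open `O ⊆ E4` with `C⁰`-pinched deviation on `O`, if `dΨ(∂₀)` is
future-directed at one point of `O` then it is future-directed at every point of `O` (it is
timelike everywhere, and a timelike field on a connected set has one time-orientation).
[cite: ONeill1983, Ch. 5, Lemma 5.26 ff., p. 145] -/
theorem isFutureDirected_mfderiv_basisVector_zero_of_norm_deviationExtend_lt_one {O : Opens E4}
    (hO : IsPreconnected (O : Set E4)) (Ψ : O → 𝓢.carrier) (hΨ : ContMDiff 𝓘(ℝ, E4) (𝓡 4) ∞ Ψ)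
    (h : ∀ y ∈ (O : Set E4), ‖𝓢.deviationExtend (Minkowski.backgroundOn O) Ψ y‖ < 1)
    {z₁ : O} (h₁ : 𝓢.timeOrientation.IsFutureDirected
      (mfderiv 𝓘(ℝ, E4) (𝓡 4) Ψ z₁ (E4.basisVector 0))) (z : O) :
    𝓢.timeOrientation.IsFutureDirected (mfderiv 𝓘(ℝ, E4) (𝓡 4) Ψ z (E4.basisVector 0)) := by
  set ψ : E4 → 𝓢.carrier := Ψ ∘ (chartAt E4 z₁).symm with hψdef
  have hψ : ContMDiffOn 𝓘(ℝ, E4) (𝓡 4) ∞ ψ O :=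
    𝓢.contMDiffOn_comp_chartAt_symm (Minkowski.backgroundOn O) Ψ z₁ hΨ
  have hd : ∀ (w : O), mfderiv 𝓘(ℝ, E4) (𝓡 4) ψ (w : E4) (E4.basisVector 0) =
      mfderiv 𝓘(ℝ, E4) (𝓡 4) Ψ w (E4.basisVector 0) := fun w ↦
    𝓢.mfderiv_comp_chartAt_symm_apply (Minkowski.backgroundOn O) Ψ z₁ w.2
      ((hΨ w).mdifferentiableAt (by simp)) _
  have hc : ∀ y ∈ (O : Set E4),
      𝓢.metric.IsCausal (mfderiv 𝓘(ℝ, E4) (𝓡 4) ψ y (E4.basisVector 0)) := by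
    intro y hy
    have hn : ‖𝓢.metricInCoords ψ y - Minkowski.bilin‖ < 1 :=
      (𝓢.norm_metricInCoords_comp_chartAt_symm_sub (Minkowski.backgroundOn O) Ψ z₁ hΨ hy).trans_lt
        (h y hy)
    exact (𝓢.isTimelike_mfderiv_basisVector_zero_of_norm_metricInCoords_sub_lt_one hn).isCausal
  -- transport between the parametrisation `ψ` at `↑w` and the chart map `Ψ` at `w`
  have hiff : ∀ w : O,
      𝓢.timeOrientation.IsFutureDirected (mfderiv 𝓘(ℝ, E4) (𝓡 4) ψ (w : E4) (E4.basisVector 0)) ↔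
        𝓢.timeOrientation.IsFutureDirected (mfderiv 𝓘(ℝ, E4) (𝓡 4) Ψ w (E4.basisVector 0)) := by
    intro w
    have hp : (chartAt E4 z₁).symm (w : E4) = w := Subtype.ext (OpensChart.chartAt_symm_val z₁ w.2)
    rw [hd w]
    show 𝓢.timeOrientation.IsFutureDirected (x := Ψ ((chartAt E4 z₁).symm (w : E4))) _ ↔ _
    rw [hp]
  have key := 𝓢.isFutureDirected_mfderiv_of_isPreconnected O.2 hψ hO subset_rfl (E4.basisVector 0)
    hc z₁.2 ((hiff z₁).2 h₁) z z.2
  exact (hiff z).1 key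

end Spacetime

end Literature.Geometry.Lorentzian

end
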